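import Mathlib
import Summits.ResolutionOfSingularities.ResolutionOfSingularities.Theorems.HomologicalConductorPersistenceSurfaceStepAddCover
import HarnessLib

/-!
# Rung S-2 `PersistenceSurface` (stmt-ResolutionOfSingularities-19970) — W4.4b U5, part 1/2:
# the DUAL NUMBERS `k[ε]` — `caⁿ(k[ε]) ⊆ (ε)`, `(ε)` is a third syzygy of itself, and `(ε)` is a retract of the
# dual block `((k[ε] ⊗ (ε)))*`

Route `ResolutionOfSingularities/HomologicalConductor`, chain W4.4b (cell res-hironaka; seat res-D-pv-043, o10-lineage
hand; object «U5» of res-L1-w44b-plan-1's CHAIN v11.1 §V11.11 (b) — the J4 inhabitant of o8's `HasStepDualCover`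
(p507867) at a maximal-conductor step; banked kernel fact per plan-1 09:27:27Z). OURS; nothing here is a statement of
the manuscript under review (Hironaka 2017); AI-written, weaker than expert review. Part 2/2
(`…PersistenceSurfaceMaximalConductorStep`) proves that every finitely generated `k[ε]`-module lies in
`add (k[ε] ⊕ (ε))` and assembles the step `HasStepDualCover T T′` from `𝔪_{T′} ⊆ ca⁴(T′)`.

* `not_isRegularLocalRing_dualNumber`, `cohomologyAnnihilatorOfDegree_dualNumber_ne_top`,
  `cohomologyAnnihilatorOfDegree_dualNumber_le` — `k[ε]` is local noetherian NOT regular (`ε ≠ 0 = ε²`), so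
  `caⁿ(k[ε]) ≠ ⊤` (`isRegularLocalRing_of_cohomologyAnnihilatorOfDegree_eq_top`) and `caⁿ(k[ε]) ⊆ (ε)` by Mathlib's
  `DualNumber.ideal_trichotomy`;
* `isSyzygy_one_spanEps`, `isSyzygy_three_spanEps` — `0 → (ε) → k[ε] → (ε) → 0` (multiplication by `ε`), iterated;
* `exists_retract_spanEps_dual`, `isRetractOfPower_dualBlock_gen` — `(ε)` is a retract of `((k[ε] ⊗_{k[ε]} (ε)))*`
  (evaluate at `1 ⊗ ε`; section through `(ε) ≅ k[ε]⧸(ε)`), so `k[ε] ⊕ (ε)` lies in `add` of the one-block generator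
  of `HasStepDualCover`.

References: S. B. Iyengar, R. Takahashi, *Annihilation of cohomology and strong generation of module categories*,
IMRN 2016 [`IyengarTakahashi2014`]; OURS planning texts (index only): L/w44b/CHAIN.md v11.1 §V11.11 (b),
L/res-L1-w44b-tri-1/dc/DC-CUSTODY.md §3.2.
-/

set_option linter.dupNamespace false

noncomputable section

open CategoryTheory Literature.RingTheory.CohomologyAnnihilator
open TrivSqZeroExt DualNumber
open Summit.ResolutionOfSingularities.ResolutionOfSingularities.Theorems.NoZeno.SandwichCluster
open Summit.ResolutionOfSingularities.ResolutionOfSingularities.Theorems.HomologicalConductor.PersistenceSurfaceRationalAssembly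
open Summit.ResolutionOfSingularities.ResolutionOfSingularities.Theorems.HomologicalConductor.PersistenceSurfaceStepAddCover
open scoped TensorProduct DualNumber

namespace Summit.ResolutionOfSingularities.ResolutionOfSingularities.Theorems.HomologicalConductor.PersistenceDualNumberAddCover

universe u

/-! ## §1 The dual numbers `k[ε]`: `caⁿ(k[ε]) ⊆ (ε)` -/

section DualNumbers

variable (k : Type u) [Field k]

/-- `k[ε]` is not a regular local ring: `ε ≠ 0` and `ε² = 0`, while regular local rings are domains. [folklore] -/
theorem not_isRegularLocalRing_dualNumber : ¬ IsRegularLocalRing k[ε] := by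
  intro h
  haveI : IsDomain k[ε] := Literature.AlgebraicGeometry.Resolution.isDomain_of_isRegularLocalRing k[ε]
  have h0 : (ε : k[ε]) = 0 := by
    have := DualNumber.eps_mul_eps (R := k)
    exact (mul_self_eq_zero).mp this
  have h1 : snd (ε : k[ε]) = (1 : k) := snd_eps
  rw [h0] at h1
  exact one_ne_zero (h1.symm.trans (snd_zero))

/-- `caⁿ(k[ε]) ≠ k[ε]` for every `n` (a noetherian local ring with `caⁿ = ⊤` is regular,
`isRegularLocalRing_of_cohomologyAnnihilatorOfDegree_eq_top`). [cite: IyengarTakahashi2014, Lemma 2.10 (2)] -/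
theorem cohomologyAnnihilatorOfDegree_dualNumber_ne_top (n : ℕ) :
    cohomologyAnnihilatorOfDegree k[ε] n ≠ ⊤ := fun h =>
  not_isRegularLocalRing_dualNumber k (isRegularLocalRing_of_cohomologyAnnihilatorOfDegree_eq_top h)

/-- `caⁿ(k[ε]) ⊆ (ε)`: by Mathlib's `DualNumber.ideal_trichotomy` every ideal of `k[ε]` is `⊥`, `(ε)` or `⊤`.
[cite: IyengarTakahashi2014, Lemma 2.10 (2)] -/
theorem cohomologyAnnihilatorOfDegree_dualNumber_le (n : ℕ) :
    cohomologyAnnihilatorOfDegree k[ε] n ≤ Ideal.span {(ε : k[ε])} := by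
  rcases DualNumber.ideal_trichotomy (cohomologyAnnihilatorOfDegree k[ε] n) with h | h | h
  · rw [h]; exact bot_le
  · rw [h]
  · exact absurd h (cohomologyAnnihilatorOfDegree_dualNumber_ne_top k n)

/-- Membership in `(ε)`: `x ∈ (ε) ↔ fst x = 0`. [folklore] -/
theorem mem_span_eps_iff (x : k[ε]) : x ∈ Ideal.span {(ε : k[ε])} ↔ fst x = 0 := by
  rw [Ideal.mem_span_singleton, ← fst_eq_zero_iff_eps_dvd]

/-- `ε • x` lies in `(ε)` for every `x`. [folklore] -/
theorem eps_mul_mem_span_eps (x : k[ε]) : (ε : k[ε]) * x ∈ Ideal.span {(ε : k[ε])} :=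
  Ideal.mul_mem_right _ _ (Ideal.subset_span rfl)

/-! ## §2 `Y := (ε)` is a third syzygy of itself -/

/-- The multiplication map `k[ε] → (ε)`, `d ↦ d • ε`, is surjective with kernel `(ε)`; so `0 → (ε) → k[ε] → (ε) → 0`
is exact and `(ε)` is a FIRST syzygy of itself. [folklore] -/
theorem isSyzygy_one_spanEps :
    IsSyzygy 1 (ModuleCat.of k[ε] ↥(Ideal.span {(ε : k[ε])})) (ModuleCat.of k[ε] ↥(Ideal.span {(ε : k[ε])})) := by
  set Y : Submodule k[ε] k[ε] := Ideal.span {(ε : k[ε])} with hY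
  have hεY : (ε : k[ε]) ∈ Y := Ideal.subset_span rfl
  -- `g : k[ε] → Y`, `d ↦ d • ε`
  let g : k[ε] →ₗ[k[ε]] ↥Y := LinearMap.codRestrict Y (LinearMap.toSpanSingleton k[ε] k[ε] (ε : k[ε]))
    (fun d => by
      rw [LinearMap.toSpanSingleton_apply, smul_eq_mul, mul_comm]
      exact eps_mul_mem_span_eps k d)
  have hg_apply : ∀ d : k[ε], ((g d : ↥Y) : k[ε]) = d * ε := fun d => by
    simp [g, LinearMap.toSpanSingleton_apply, smul_eq_mul]
  have hg : Function.Surjective g := by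
    rintro ⟨y, hy⟩
    obtain ⟨d, rfl⟩ := Ideal.mem_span_singleton'.mp hy
    exact ⟨d, Subtype.ext (by rw [hg_apply])⟩
  have hf : Function.Injective Y.subtype := Subtype.val_injective
  have hfg : Function.Exact Y.subtype g := by
    intro d
    constructor
    · intro hd
      have h0 : d * ε = 0 := by rw [← hg_apply, hd]; rfl
      have : fst d = 0 := by
        have := congrArg snd h0
        simpa [DualNumber.snd_mul] using this
      exact ⟨⟨d, (mem_span_eps_iff k d).mpr this⟩, rfl⟩
    · rintro ⟨⟨d', hd'⟩, rfl⟩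
      apply Subtype.ext
      rw [hg_apply]
      change d' * ε = 0
      have h1 : fst d' = 0 := (mem_span_eps_iff k d').mp hd'
      refine TrivSqZeroExt.ext ?_ ?_
      · simp [h1]
      · simp [h1]
  obtain ⟨w, hS⟩ := exists_shortExact_of_linearMap (Y := ModuleCat.of k[ε] ↥Y) (M := ModuleCat.of k[ε] k[ε])
    (X := ModuleCat.of k[ε] ↥Y) Y.subtype g hf hg hfg
  exact isSyzygy_one_iff.mpr ⟨ModuleCat.of k[ε] k[ε], inferInstance,
    (IsProjective.iff_projective (R := k[ε]) k[ε]).mp inferInstance, _, _, w, hS⟩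

/-- `(ε)` is a THIRD syzygy of itself over `k[ε]` (iterate `isSyzygy_one_spanEps`). [folklore] -/
theorem isSyzygy_three_spanEps :
    IsSyzygy 3 (ModuleCat.of k[ε] ↥(Ideal.span {(ε : k[ε])})) (ModuleCat.of k[ε] ↥(Ideal.span {(ε : k[ε])})) :=
  (isSyzygy_one_spanEps k).trans ((isSyzygy_one_spanEps k).trans (isSyzygy_one_spanEps k))

/-! ## §3 The block: `(ε)` is a retract of `((k[ε] ⊗ (ε)))*` -/

/-- **`Y = (ε)` is a retract of the dual block `(k[ε] ⊗_{k[ε]} Y)*`.** Retraction: evaluate a functional at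
`1 ⊗ ε` (the value is killed by `ε`, hence lies in `(ε)`); section: `Y ≅ k[ε]⧸(ε)` (via `d ↦ d•ε`) and
`d ↦ d • ψ₀`, `ψ₀ := (Y ↪ k[ε]) ∘ lid`, kills `(ε)`. [folklore] -/
theorem exists_retract_spanEps_dual :
    ∃ (i : ↥(Ideal.span {(ε : k[ε])}) →ₗ[k[ε]]
        Module.Dual k[ε] (k[ε] ⊗[k[ε]] ↥(Ideal.span {(ε : k[ε])})))
      (r : Module.Dual k[ε] (k[ε] ⊗[k[ε]] ↥(Ideal.span {(ε : k[ε])})) →ₗ[k[ε]]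
        ↥(Ideal.span {(ε : k[ε])})), r ∘ₗ i = LinearMap.id := by
  set Y : Submodule k[ε] k[ε] := Ideal.span {(ε : k[ε])} with hY
  have hεY : (ε : k[ε]) ∈ Y := Ideal.subset_span rfl
  -- `g : k[ε] → Y`, `d ↦ d • ε` (as in §2)
  let g : k[ε] →ₗ[k[ε]] ↥Y := LinearMap.codRestrict Y (LinearMap.toSpanSingleton k[ε] k[ε] (ε : k[ε]))
    (fun d => by
      rw [LinearMap.toSpanSingleton_apply, smul_eq_mul, mul_comm]
      exact eps_mul_mem_span_eps k d)
  have hg_apply : ∀ d : k[ε], ((g d : ↥Y) : k[ε]) = d * ε := fun d => by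
    simp [g, LinearMap.toSpanSingleton_apply, smul_eq_mul]
  have hg : Function.Surjective g := by
    rintro ⟨y, hy⟩
    obtain ⟨d, rfl⟩ := Ideal.mem_span_singleton'.mp hy
    exact ⟨d, Subtype.ext (by rw [hg_apply])⟩
  have hker : ∀ d : k[ε], d ∈ LinearMap.ker g ↔ fst d = 0 := fun d => by
    rw [LinearMap.mem_ker]
    constructor
    · intro hd
      have h0 : d * ε = 0 := by rw [← hg_apply, hd]; rfl
      have := congrArg snd h0
      simpa [DualNumber.snd_mul] using this
    · intro hd
      apply Subtype.ext
      rw [hg_apply]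
      change d * ε = 0
      exact TrivSqZeroExt.ext (by simp [hd]) (by simp [hd])
  -- `ψ₀ : k[ε] ⊗ Y → k[ε]`, the inclusion after `lid`
  let ψ₀ : Module.Dual k[ε] (k[ε] ⊗[k[ε]] ↥Y) := Y.subtype ∘ₗ (TensorProduct.lid k[ε] ↥Y).toLinearMap
  have hψ₀ : ∀ (d : k[ε]) (y : ↥Y), ψ₀ (d ⊗ₜ y) = d * (y : k[ε]) := fun d y => by
    simp [ψ₀, TensorProduct.lid_tmul, smul_eq_mul]
  -- products of two elements of `(ε)` vanish
  have hmul0 : ∀ a b : k[ε], fst a = 0 → fst b = 0 → a * b = 0 := fun a b ha hb =>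
    TrivSqZeroExt.ext (by simp [ha]) (by simp [ha, hb])
  -- the section `i := liftQ (d ↦ d • ψ₀) ∘ (Y ≅ k[ε] ⧸ ker g)`
  have hle : LinearMap.ker g ≤ LinearMap.ker (LinearMap.toSpanSingleton k[ε] _ ψ₀) := by
    intro d hd
    rw [LinearMap.mem_ker, LinearMap.toSpanSingleton_apply]
    apply TensorProduct.ext'
    intro a y
    rw [LinearMap.smul_apply, LinearMap.zero_apply, hψ₀, smul_eq_mul]
    exact hmul0 _ _ ((hker d).mp hd) (by
      have : fst (a * (y : k[ε])) = fst a * fst (y : k[ε]) := TrivSqZeroExt.fst_mul a y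
      rw [this, (mem_span_eps_iff k _).mp y.2, mul_zero])
  let i : ↥Y →ₗ[k[ε]] Module.Dual k[ε] (k[ε] ⊗[k[ε]] ↥Y) :=
    ((LinearMap.ker g).liftQ (LinearMap.toSpanSingleton k[ε] _ ψ₀) hle) ∘ₗ
      (g.quotKerEquivOfSurjective hg).symm.toLinearMap
  have hi : ∀ d : k[ε], i (g d) = d • ψ₀ := fun d => by
    simp only [i, LinearMap.comp_apply, LinearEquiv.coe_coe, LinearMap.quotKerEquivOfSurjective_symm_apply,
      Submodule.liftQ_apply, LinearMap.toSpanSingleton_apply]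
  -- the retraction `r := evaluation at 1 ⊗ ε`, with values in `(ε)`
  have hεε : (ε : k[ε]) • (⟨ε, hεY⟩ : ↥Y) = 0 := Subtype.ext (by
    change (ε : k[ε]) * ε = 0
    exact DualNumber.eps_mul_eps)
  have hmem : ∀ φ : Module.Dual k[ε] (k[ε] ⊗[k[ε]] ↥Y), φ ((1 : k[ε]) ⊗ₜ ⟨ε, hεY⟩) ∈ Y := fun φ => by
    rw [mem_span_eps_iff]
    have h1 : (ε : k[ε]) • φ ((1 : k[ε]) ⊗ₜ ⟨ε, hεY⟩) = 0 := by
      rw [← map_smul, TensorProduct.smul_tmul', TensorProduct.smul_tmul, hεε, TensorProduct.tmul_zero, map_zero]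
    have h2 := congrArg snd h1
    simpa [DualNumber.snd_mul] using h2
  let r : Module.Dual k[ε] (k[ε] ⊗[k[ε]] ↥Y) →ₗ[k[ε]] ↥Y :=
    LinearMap.codRestrict Y (LinearMap.applyₗ ((1 : k[ε]) ⊗ₜ (⟨ε, hεY⟩ : ↥Y))) hmem
  have hr : ∀ φ, ((r φ : ↥Y) : k[ε]) = φ ((1 : k[ε]) ⊗ₜ ⟨ε, hεY⟩) := fun φ => rfl
  refine ⟨i, r, LinearMap.ext fun y => ?_⟩
  obtain ⟨d, rfl⟩ := hg y
  apply Subtype.ext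
  rw [LinearMap.comp_apply, hi, hr, LinearMap.smul_apply, hψ₀, LinearMap.id_apply, hg_apply, smul_eq_mul, one_mul]

/-- `(ε)` lies in `add (k[ε] ⊕ ((k[ε] ⊗ (ε)))*)` — the generator shape of o8's `HasStepDualCover` with ONE block —
and so does `k[ε]`; hence `k[ε] ⊕ (ε)` does. [cite: IyengarTakahashi2014, Definition 4.1] -/
theorem isRetractOfPower_dualBlock_gen :
    IsRetractOfPower
      (ModuleCat.of k[ε] (k[ε] × (Π _ : Fin 1, Module.Dual k[ε] (k[ε] ⊗[k[ε]] ↥(Ideal.span {(ε : k[ε])})))))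
      (ModuleCat.of k[ε] (k[ε] × ↥(Ideal.span {(ε : k[ε])}))) := by
  obtain ⟨i, r, hri⟩ := exists_retract_spanEps_dual k
  have hD := isRetractOfPower_fst (ModuleCat.of k[ε] k[ε])
    (ModuleCat.of k[ε] (Π _ : Fin 1, Module.Dual k[ε] (k[ε] ⊗[k[ε]] ↥(Ideal.span {(ε : k[ε])}))))
  have hB := isRetractOfPower_snd (ModuleCat.of k[ε] k[ε])
    (ModuleCat.of k[ε] (Π _ : Fin 1, Module.Dual k[ε] (k[ε] ⊗[k[ε]] ↥(Ideal.span {(ε : k[ε])}))))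
  -- `Y` is a retract of `Π _ : Fin 1, block`
  have hY : IsRetractOfPower
      (ModuleCat.of k[ε] (k[ε] × (Π _ : Fin 1, Module.Dual k[ε] (k[ε] ⊗[k[ε]] ↥(Ideal.span {(ε : k[ε])})))))
      (ModuleCat.of k[ε] ↥(Ideal.span {(ε : k[ε])})) :=
    hB.of_retract (ModuleCat.ofHom ((LinearMap.pi fun _ => LinearMap.id) ∘ₗ i))
      (ModuleCat.ofHom (r ∘ₗ LinearMap.proj 0)) (by
        apply ModuleCat.hom_ext
        refine LinearMap.ext fun y => ?_
        simp only [ModuleCat.hom_comp, ModuleCat.hom_ofHom, LinearMap.comp_apply, LinearMap.pi_apply,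
          LinearMap.proj_apply, LinearMap.id_apply, ModuleCat.hom_id]
        exact LinearMap.congr_fun hri y)
  exact hD.prod hY

end DualNumbers

end Summit.ResolutionOfSingularities.ResolutionOfSingularities.Theorems.HomologicalConductor.PersistenceDualNumberAddCover

end
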